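import Summits.QuantumFields.QCD.Theorems.QuarksNoInfraredClauseThinQCDCountableOffDiagDensity
import Summits.QuantumFields.QCD.Theorems.QuarksNoInfraredClauseThinQCDDiagonalLipschitz
import Summits.QuantumFields.QCD.Theorems.QuarksAsStableActionStableActionBridgeDefs
import HarnessLib

/-!
# Stub `stub_diagonalExtraction` (DE) of line `registered` (skeleton r5) — crux `ThinQCD` (item stmt-QuantumFields-17278)

Route `QuarksNoInfraredClause`, crux decl `Summit.QuantumFields.QCD.Theses.QuarksNoInfraredClause.ThinQCD`; helper file,
`--supports stmt-QuantumFields-17278`.  PURE ANALYSIS (no physics): for ANY calibrated species family `𝒞` over ANY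
regularisation, ⁰𝒮-tightness of the canonical lattice distributions `qcdLatticeDist (𝒞.scheme m) k n σ` locally uniformly
on compacts of positive mass tuples, together with an eventually-uniform mass-Lipschitz modulus, gives ONE strictly
increasing `ψ` along which `k ↦ qcdLatticeDist (𝒞.scheme m) (ψ k) n σ F` converges for EVERY positive tuple `m`, every
arity `n`, species string `σ` and every `F ∈ ⁰𝒮((ℝ⁴)ⁿ)`.

Proof.  (1) `tendsto_offDiagonal_of_generators` — the ε/3 lemma of `tendsto_offDiagonal_of_tensor`
(`…StableActionBridgeSoftClosureTensor.lean`) for an ARBITRARY generating family of `⁰𝒮`: eventually uniformly bounded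
functionals converging on the generators converge on the closure of their span.  (2) A COUNTABLE family `𝒢 n` of
off-diagonal real tensors is total in `⁰𝒮` (`…ThinQCDCountableOffDiagDensity.lean`, `exists_countable_total`).  (3) The eventual-Lipschitz
Arzelà–Ascoli lemma `exists_strictMono_forall_pos_tendsto` (`…ThinQCDDiagonalLipschitz.lean`, p155449) over the countable
labels `(n, σ, generator)` gives `ψ` with convergence on every generator at every positive tuple; (1)+(2) upgrade it to all
of `⁰𝒮`.

Refs: Reed–Simon I, Thm I.2 / §V.3 (ε/3); Arzelà–Ascoli / Cantor diagonal (folklore).  No definition, no named fact, no `sorry`.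
-/

noncomputable section

open scoped SchwartzMap Topology
open Filter Set
open Literature.MathematicalPhysics.AQFT Literature.MathematicalPhysics.QuantumLattice
  Literature.MathematicalPhysics.QuantumFieldTheory
open Summit.QuantumFields.QCD.Cruxes.StableActionBridge.Sketch (qcdLatticeDist)
open Summit.QuantumFields.QCD.Cruxes.ThinQCD.Registered (exists_countable_total exists_strictMono_forall_pos_tendsto)

namespace Summit.QuantumFields.QCD.Cruxes.ThinQCD.Registered

/-! ### The ε/3 lemma for an arbitrary generating family of `⁰𝒮` -/

/-- **ε/3-reduction over a generating family.**  Let `u k` be continuous linear functionals on `𝓢((ℝ⁴)ⁿ, ℂ)` that are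
EVENTUALLY uniformly bounded on `⁰𝒮` by a multiple of one Schwartz norm `|·|_M`, let `𝒢 ⊆ ⁰𝒮` be a family whose span is
dense in `⁰𝒮`, and assume `u k G` converges for every `G ∈ 𝒢`.  Then `u k F` converges for every `F ∈ ⁰𝒮`.
[cite: ReedSimonI1980, Thm I.2 (BLT) / §V.3] -/
theorem tendsto_offDiagonal_of_generators {n : ℕ} (u : ℕ → 𝓢((Fin n → (EuclideanSpace ℝ (Fin 4))), ℂ) →L[ℂ] ℂ) {C : ℝ} {M : ℕ}
    (𝒢 : Set 𝓢((Fin n → (EuclideanSpace ℝ (Fin 4))), ℂ))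
    (hb : ∀ᶠ k in atTop, ∀ F : 𝓢((Fin n → (EuclideanSpace ℝ (Fin 4))), ℂ), IsOffDiagonal F → ‖u k F‖ ≤ C * schwartzNorm M F)
    (h𝒢 : ∀ G ∈ 𝒢, IsOffDiagonal G)
    (hdense : ∀ F : 𝓢((Fin n → (EuclideanSpace ℝ (Fin 4))), ℂ), IsOffDiagonal F →
      F ∈ closure ((Submodule.span ℂ 𝒢 : Submodule ℂ 𝓢((Fin n → (EuclideanSpace ℝ (Fin 4))), ℂ)) : Set 𝓢((Fin n → (EuclideanSpace ℝ (Fin 4))), ℂ)))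
    (hconv : ∀ G ∈ 𝒢, ∃ c : ℂ, Tendsto (fun k => u k G) atTop (𝓝 c)) :
    ∀ F : 𝓢((Fin n → (EuclideanSpace ℝ (Fin 4))), ℂ), IsOffDiagonal F → ∃ c : ℂ, Tendsto (fun k => u k F) atTop (𝓝 c) := by
  -- adapted from `Summit.QuantumFields.QCD.Cruxes.StableActionBridge.Sketch.tendsto_offDiagonal_of_tensor`
  intro F hF
  classical
  -- (1) the span consists of off-diagonal functions on which `u k` converges
  have hspan : ∀ G ∈ (Submodule.span ℂ 𝒢 : Submodule ℂ 𝓢((Fin n → (EuclideanSpace ℝ (Fin 4))), ℂ)),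
      IsOffDiagonal G ∧ ∃ c : ℂ, Tendsto (fun k => u k G) atTop (𝓝 c) := by
    intro G hG
    refine Submodule.span_induction ?_ ?_ ?_ ?_ hG
    · intro G hG𝒢
      exact ⟨h𝒢 G hG𝒢, hconv G hG𝒢⟩
    · exact ⟨isOffDiagonal_zero, 0, by simpa only [map_zero] using tendsto_const_nhds⟩
    · rintro G G' - - ⟨hGo, c, hc⟩ ⟨hG'o, c', hc'⟩
      exact ⟨hGo.add hG'o, c + c', by simpa only [map_add] using hc.add hc'⟩
    · rintro a G - ⟨hGo, c, hc⟩
      exact ⟨hGo.smul a, a • c, by simpa only [map_smul] using hc.const_smul a⟩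
  -- (2) `u k F` is Cauchy
  have hCauchy : CauchySeq fun k => u k F := by
    rw [Metric.cauchySeq_iff]
    intro ε hε
    set C' : ℝ := |C| + 1 with hC'def
    have hC' : 0 < C' := by positivity
    set δ : ℝ := ε / (4 * C') with hδdef
    have hδ : 0 < δ := by positivity
    have hC'δ : C' * δ = ε / 4 := by
      rw [hδdef]
      field_simp
    -- a `G` in the span with `|F - G|_M < δ`
    have hqc : Continuous fun G : 𝓢((Fin n → (EuclideanSpace ℝ (Fin 4))), ℂ) => schwartzNorm M G :=
      Seminorm.continuous_finsetSup (s := Finset.Iic (M, M)) fun i _ =>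
        (schwartz_withSeminorms ℂ (Fin n → (EuclideanSpace ℝ (Fin 4))) ℂ).continuous_seminorm i
    have hcont : Continuous fun G : 𝓢((Fin n → (EuclideanSpace ℝ (Fin 4))), ℂ) => schwartzNorm M (F - G) :=
      hqc.comp (continuous_const.sub continuous_id)
    have hnhds : {G : 𝓢((Fin n → (EuclideanSpace ℝ (Fin 4))), ℂ) | schwartzNorm M (F - G) < δ} ∈ 𝓝 F := by
      refine (isOpen_lt hcont continuous_const).mem_nhds ?_
      show schwartzNorm M (F - F) < δ
      have h0 : schwartzNorm M (0 : 𝓢((Fin n → (EuclideanSpace ℝ (Fin 4))), ℂ)) = 0 := map_zero _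
      rw [sub_self, h0]
      exact hδ
    obtain ⟨G, hGδ, hGV⟩ := mem_closure_iff_nhds.1 (hdense F hF) _ hnhds
    obtain ⟨hGo, c, hc⟩ := hspan G hGV
    have hcG := hc.cauchySeq
    rw [Metric.cauchySeq_iff] at hcG
    obtain ⟨N₁, hN₁⟩ := hcG (ε / 4) (by positivity)
    obtain ⟨N₂, hN₂⟩ := eventually_atTop.1 hb
    refine ⟨max N₁ N₂, fun j hj k hk => ?_⟩
    have hFG : IsOffDiagonal (F - G) := hF.sub hGo
    have hsn : 0 ≤ schwartzNorm M (F - G) := apply_nonneg _ _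
    have hest : ∀ l, N₂ ≤ l → ‖u l (F - G)‖ ≤ ε / 4 := by
      intro l hl
      calc ‖u l (F - G)‖ ≤ C * schwartzNorm M (F - G) := hN₂ l hl _ hFG
        _ ≤ |C| * schwartzNorm M (F - G) := by gcongr; exact le_abs_self C
        _ ≤ C' * schwartzNorm M (F - G) := by gcongr; simp [hC'def]
        _ ≤ C' * δ := by gcongr; exact le_of_lt hGδ
        _ = ε / 4 := hC'δ
    have hj₂ := hest j (le_of_max_le_right hj)
    have hk₂ := hest k (le_of_max_le_right hk)
    have hjk := hN₁ j (le_of_max_le_left hj) k (le_of_max_le_left hk)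
    rw [dist_eq_norm] at hjk ⊢
    have hsplit : u j F - u k F = (u j (F - G) - u k (F - G)) + (u j G - u k G) := by
      simp only [map_sub]
      abel
    calc ‖u j F - u k F‖ = ‖(u j (F - G) - u k (F - G)) + (u j G - u k G)‖ := by rw [hsplit]
      _ ≤ ‖u j (F - G) - u k (F - G)‖ + ‖u j G - u k G‖ := norm_add_le _ _
      _ ≤ (‖u j (F - G)‖ + ‖u k (F - G)‖) + ‖u j G - u k G‖ := by gcongr; exact norm_sub_le _ _
      _ ≤ (ε / 4 + ε / 4) + ‖u j G - u k G‖ := by gcongr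
      _ < (ε / 4 + ε / 4) + ε / 4 := by gcongr
      _ < ε := by linarith
  exact cauchySeq_tendsto_of_complete hCauchy

end Summit.QuantumFields.QCD.Cruxes.ThinQCD.Registered

/-! ### The stub -/

namespace Summit.QuantumFields.QCD.Theorems.ThinQCD

/-- **(DE) Diagonal extraction** — registered stub `stub_diagonalExtraction` of skeleton r5 of line `registered`
(crux `ThinQCD`, stmt-QuantumFields-17278), signature verbatim.  For any calibrated family: ⁰𝒮-tightness locally uniform on
compacts of positive tuples + eventually-uniform mass-Lipschitz continuity ⇒ ONE strictly increasing `ψ` along which every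
canonical lattice distribution converges at every positive tuple.  Labels `(n, σ, G)` with `G` ranging over a countable
total family of off-diagonal real tensors (`exists_countable_total`); the Arzelà–Ascoli lemma gives `ψ` and convergence on generators; the ε/3 lemma and the
totality of `genSet n` give convergence on all of `⁰𝒮`. [folklore] -/
theorem stub_diagonalExtraction :
    ∀ (Nf : ℕ) (reg : QCDRegularisation Nf) (𝒞 : CalibratedSpeciesFamily reg),
    (∀ K : Set (Fin Nf → ℝ), IsCompact K → K ⊆ {m | ∀ fl, 0 < m fl} →
      ∃ (s : ℕ) (α β : ℝ), 0 ≤ α ∧ ∀ (n : ℕ) (σ : Fin n → QCDField Nf), ∀ᶠ k in Filter.atTop, ∀ m ∈ K,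
        ∀ F : SchwartzMap (Fin n → EuclideanSpace ℝ (Fin 4)) ℂ, IsOffDiagonal F →
          ‖qcdLatticeDist (𝒞.scheme m) k n σ F‖ ≤ α * (n.factorial : ℝ) ^ β * schwartzNorm (n * s) F) →
    (∀ (n : ℕ) (σ : Fin n → QCDField Nf) (F : SchwartzMap (Fin n → EuclideanSpace ℝ (Fin 4)) ℂ),
      IsOffDiagonal F → ∀ K : Set (Fin Nf → ℝ), IsCompact K → K ⊆ {m | ∀ fl, 0 < m fl} →
        ∃ C : ℝ, ∀ᶠ k in Filter.atTop, ∀ m ∈ K, ∀ m' ∈ K,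
          ‖qcdLatticeDist (𝒞.scheme m) k n σ F - qcdLatticeDist (𝒞.scheme m') k n σ F‖ ≤ C * ‖m - m'‖) →
    ∃ ψ : ℕ → ℕ, StrictMono ψ ∧ ∀ m : Fin Nf → ℝ, (∀ f, 0 < m f) →
      ∀ (n : ℕ) (σ : Fin n → QCDField Nf) (F : SchwartzMap (Fin n → EuclideanSpace ℝ (Fin 4)) ℂ), IsOffDiagonal F →
        ∃ c : ℂ, Filter.Tendsto (fun k : ℕ => qcdLatticeDist (𝒞.scheme m) (ψ k) n σ F) Filter.atTop (nhds c) := by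
  intro Nf reg 𝒞 hT hL
  -- a countable total family of off-diagonal real tensors in each degree
  choose 𝒢 h𝒢c h𝒢off h𝒢tot using fun n : ℕ => exists_countable_total n
  haveI : ∀ n : ℕ, Countable (𝒢 n) := fun n => (h𝒢c n).to_subtype
  -- the countable labels `(n, σ, G)` and the Arzelà–Ascoli extraction
  obtain ⟨ψ, hψ, hlim⟩ := exists_strictMono_forall_pos_tendsto (ι := Σ n : ℕ, (Fin n → QCDField Nf) × 𝒢 n)
    (fun k i m => qcdLatticeDist (𝒞.scheme m) k i.1 i.2.1 (i.2.2 : SchwartzMap (Fin i.1 → EuclideanSpace ℝ (Fin 4)) ℂ))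
    (fun i m hm => by
      -- eventual bounds at every positive tuple (tightness on the compact `{m}`)
      obtain ⟨n, σ, G⟩ := i
      obtain ⟨s, α, β, -, hbound⟩ := hT {m} isCompact_singleton (by simpa using hm)
      exact ⟨α * (n.factorial : ℝ) ^ β * schwartzNorm (n * s) (G : SchwartzMap (Fin n → EuclideanSpace ℝ (Fin 4)) ℂ),
        (hbound n σ).mono fun k hk => hk m rfl _ (h𝒢off n G G.2).2⟩)
    (fun i K hK hKP => by
      -- the eventually-uniform Lipschitz modulus on compacts
      obtain ⟨n, σ, G⟩ := i
      obtain ⟨C, hC⟩ := hL n σ (G : SchwartzMap (Fin n → EuclideanSpace ℝ (Fin 4)) ℂ) (h𝒢off n G G.2).2 K hK hKP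
      exact ⟨C, hC.mono fun k hk m hm m' hm' => hk m hm m' hm'⟩)
  -- assembly at a positive tuple `m`: ε/3 over the total countable family `𝒢 n`
  refine ⟨ψ, hψ, fun m hm n σ => ?_⟩
  obtain ⟨s, α, β, -, hbound⟩ := hT {m} isCompact_singleton (by simpa using hm)
  refine Summit.QuantumFields.QCD.Cruxes.ThinQCD.Registered.tendsto_offDiagonal_of_generators
    (fun k => qcdLatticeDist (𝒞.scheme m) (ψ k) n σ) (𝒢 n) (C := α * (n.factorial : ℝ) ^ β) (M := n * s)
    ((hψ.tendsto_atTop.eventually (hbound n σ)).mono fun k hk F hF => hk m rfl F hF)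
    (fun G hG => (h𝒢off n G hG).2) (h𝒢tot n) fun G hG => ?_
  obtain ⟨l, hl⟩ := hlim m hm ⟨n, σ, ⟨G, hG⟩⟩
  exact ⟨l, hl⟩

end Summit.QuantumFields.QCD.Theorems.ThinQCD

end
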